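import Summits.AnomalousDissipation.AnomalousDissipation.Theses.KolmogorovPincer

/-!
# Assembly item `KolmogorovPincer.Assembly` (stmt-AnomalousDissipation-32243), proved — rev-14 repair

Route `KolmogorovPincer` (decomp-ad cell, child of `RootDecompCycle1` on the blocker `RestMeanFloorTG`),
item `Assembly` (rank 1): the route's implication
`TaylorGreenForceRegularTG → RestMeanCeilingTG → RefinedSimilarityFloorTG → KolmogorovCeilingTG →
IncrementPincerTG → AnomalousDissipation`.

Since route rev 12–14 (E1 quantifier trim) the gate-written deciding theorem `KolmogorovPincer.closes`
takes the SEQUENTIAL floor `RefinedSimilarityFloorSeqTG` (stmt-27497, the declared residual) in its third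
slot, while the (closed) `Assembly` decl still chains through the `∀ ν ∈ (0, ν₁)` floor
`RefinedSimilarityFloorTG` (stmt-32239, now an aside).  The old one-line proof
`fun hF hC hX hY hP => closes hF hC hX hY hP` therefore no longer type-checks (buildfix B38-N7).  The
statement of `Assembly` is nevertheless TRUE as recorded: the `∀ν` floor implies the sequential floor along
`ν_j := ν₁ / (j + 2)` (a local `have`, five lines of real analysis: positivity, `ν_j < ν₁`, `ν_j → 0` by
`Filter.Tendsto.div_atTop`), and then `closes` applies.  The implication is kept LOCAL (not a named
theorem) so that no declaration of this module has a route item other than `Assembly` as the head of its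
type.  Nothing here proves the summit or any crux; the closed item 32243 keeps its recorded statement (no
restatement, no reopen).  [folklore]
-/

-- `Summit.<Summit>.<Problem>` is the tree's mandated summit-side namespace (CONVENTIONS §2); for this
-- single-conjunct summit the two coincide, so the duplicate is deliberate.
set_option linter.dupNamespace false

namespace Summit.AnomalousDissipation.AnomalousDissipation.Theorems.KolmogorovPincerAssembly

open Summit.AnomalousDissipation.AnomalousDissipation.Theses

/-- **Route decl `KolmogorovPincer.Assembly` (stmt-AnomalousDissipation-32243), proved**: the route's
five items imply `AnomalousDissipation`, by the route file's own deciding theorem `KolmogorovPincer.closes`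
(rev 14: third binder `RefinedSimilarityFloorSeqTG`, reached from the `∀ν` floor `RefinedSimilarityFloorTG`
along `ν_j := ν₁ / (j + 2)`).  [folklore] -/
theorem kolmogorovPincer_assembly : KolmogorovPincer.Assembly := by
  intro hF hC hX hY hP
  have hXs : KolmogorovPincer.RefinedSimilarityFloorSeqTG := by
    intro f hf
    obtain ⟨ε, ν₁, hε, hν₁, hall⟩ := hX f hf
    refine ⟨ε, hε, fun j => ν₁ / ((j : ℝ) + 2), fun j => by positivity, ?_, fun j => ?_⟩
    · exact tendsto_const_nhds.div_atTop
        (Filter.tendsto_atTop_add_const_right _ _ tendsto_natCast_atTop_atTop)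
    · have hpos : 0 < ν₁ / ((j : ℝ) + 2) := by positivity
      have hlt : ν₁ / ((j : ℝ) + 2) < ν₁ :=
        div_lt_self hν₁ (by have : (0 : ℝ) ≤ (j : ℝ) := Nat.cast_nonneg j; linarith)
      exact hall _ hpos hlt
  exact KolmogorovPincer.closes hF hC hXs hY hP

end Summit.AnomalousDissipation.AnomalousDissipation.Theorems.KolmogorovPincerAssembly
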